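import Summits.CriticalPhenomena.PercolationContinuityZ3.Theorems.PercNearOneGluingNoHeavyLowerTailSahiTangentScaling
import Summits.CriticalPhenomena.PercolationContinuityZ3.Theorems.PercNearOneGluingNoHeavyLowerTailSahiTangentDisjointSlot
import Summits.CriticalPhenomena.PercolationContinuityZ3.Theorems.PercNearOneGluingNoHeavyLowerTailSahiCubeThreeAllOrdersBirkhoff
import Summits.CriticalPhenomena.PercolationContinuityZ3.Theorems.PercNearOneGluingNoHeavyLowerTailSahiTwoDimFKG
import Literature.Combinatorics.Sahi2008.UniformSquareAllOrders
import Literature.Combinatorics.Sahi2008.Indicators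

/-!
# `NoHeavyLowerTail` (crux stmt-CriticalPhenomena-4575), Sahi programme: **CONJECTURE V_∅ AT EVERY ORDER** — the coin / vertex form
# of the scaling identity: `s·E_n^{ν}(f) ≤ E_n^{B_s⊗ν}(ε·f_0,…,ε·f_{n−1})` under Sahi positivity of the proper sub-families; the monotone
# form `s ↦ E_n^{B_s⊗ν}(ε·f)/s` non-increasing; Sahi-positive / FKG / unconditional instances

Support file (Sahi cell, seat `prim-sahi-p1`, generation 51; `--supports stmt-CriticalPhenomena-4575`).  Companion of
`…SahiTangentScaling` (the identity `E_n^{s·μ}(f) = Σ_π φ_{|π|}(s) Π_{B∈π} E_{|B|}^{μ}(f|_B)`).  Pure proofs, no definitions, no `sorry`,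
standard axioms.

CONTENT.
* §1 `sahiE_smul_nonneg_of_sub`, `mul_sahiE_smul_le`: under positivity of the sub-families, `E^{s·μ} ≥ 0` and
  **`r·E_{n+1}^{s·μ}(f) ≤ s·E_{n+1}^{r·μ}(f)` for `0 ≤ r ≤ s ≤ 1`** — `s ↦ E^{s·μ}(f)/s` is non-increasing on `(0,1]` (the chord
  inequality of the companion file self-improves: the weight `s·μ` has nonnegative proper sub-family functionals by the scaling sum).
* §2 THE COIN FORM.  On `Bool × α` with the product weight `B_s ⊗ ν` (`(1,x) ↦ s·ν(x)`, `(0,x) ↦ (1−s)·ν(x)`), the TOP-ONLY family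
  `F_l(ε,x) = ε ? f_l(x) : 0` has the functionals of `f` under `s·ν` (`sahiE_coin_topOnly_eq_smul`, by `sahiE_congr_of_moments`); hence
  **`s·E_{n+1}^{ν}(f) ≤ E_{n+1}^{B_s⊗ν}(ε·f)`** whenever the proper sub-families of `f` have `E_m^{ν} ≥ 0` (`mul_sahiE_le_sahiE_coin_topOnly`)
  — for increasing events `A_l` and an INDEPENDENT event `P`: `E_{n+1}(A_0∩P,…,A_n∩P) ≥ μ(P)·E_{n+1}(A_0,…,A_n)` — and the ratio form.
  This is CONJECTURE V_∅ / A_n of memo FROM-prim-sahi-p1-gen50 §5 at EVERY order, conditionally on Sahi positivity of orders `≤ n` of the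
  sub-families; gen 50 has orders `≤ 5` unconditionally under FKG (`…VertexFourFKG`, `…VertexFiveFKG(Mixed)`, `…VertexRatioFKG`).
* §3 Sahi-positive weights (`SahiPositive μ n` ⟹ all orders `≤ n`, `SahiPositive.anti`): for nonnegative monotone `f_0,…,f_n` the three
  statements hold with hypothesis `SahiPositive μ n` only (order `n + 1` is NOT needed; `E^{s·μ}_{n+1} ≥ 0` needs order `n + 1`).
* §4 FKG lattices: the event form for arbitrary up-sets given `SahiPositive ν n`; UNCONDITIONAL instances (order 3 on every FKG lattice is gen 50's
  `sahiE_three_coin_topOnly_ge`) — EVERY order on FKG lattices with at most three join-irreducibles (`SahiCubeAllOrders.sahiPositive_of_card_supIrred_le_three`)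
  and on two-dimensional grids `α × β` (`SahiTwoDim.sahiPositive_of_isFKGMeasure_prod`).  (Product measures on `≤ 5` coordinates are
  Sahi-positive at every order in the tree too, but through declared `native_decide` certificates, so that instance is not restated here.)
Nothing conjectural is asserted. [this work]
-/

namespace Summit.CriticalPhenomena.PercolationContinuityZ3.Theorems.SahiTangent

open Finset Function Literature.Combinatorics.Sahi2008
open scoped BigOperators

noncomputable section

variable {α : Type*} [Fintype α] {n : ℕ}

/-! ### §1 Positivity under the scaled weight and the monotone (ratio) form -/

/-- **Positivity of `E` under the scaled weight.**  If ALL sub-families of `f` of size `≤ n + 1` (read increasingly, including `f`)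
have `E_m^{μ} ≥ 0` and `0 ≤ s ≤ 1`, then `E_{n+1}^{s·μ}(f) ≥ 0` (every term of the scaling sum is `≥ 0`). [this work] -/
theorem sahiE_smul_nonneg_of_sub (μ : α → ℝ) {s : ℝ} (hs0 : 0 ≤ s) (hs1 : s ≤ 1) (n : ℕ) (f : Fin (n + 1) → α → ℝ)
    (hpos : ∀ m, m ≤ n + 1 → ∀ e : Fin m → Fin (n + 1), StrictMono e → 0 ≤ sahiE μ m (fun j => f (e j))) :
    0 ≤ sahiE (s • μ) (n + 1) f := by
  have hself : 0 ≤ sahiE μ (n + 1) f := hpos (n + 1) le_rfl id strictMono_id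
  have h := mul_sahiE_le_sahiE_smul μ hs0 hs1 f fun m hm e he => hpos m (Nat.le_succ_of_le hm) e he
  exact le_trans (mul_nonneg hs0 hself) h

/-- Proper sub-families stay nonnegative under the scaled weight (`0 ≤ s ≤ 1`). [this work] -/
theorem sub_sahiE_smul_nonneg (μ : α → ℝ) {s : ℝ} (hs0 : 0 ≤ s) (hs1 : s ≤ 1) (f : Fin (n + 1) → α → ℝ)
    (hpos : ∀ m, m ≤ n → ∀ e : Fin m → Fin (n + 1), StrictMono e → 0 ≤ sahiE μ m (fun j => f (e j))) :
    ∀ m, m ≤ n → ∀ e : Fin m → Fin (n + 1), StrictMono e → 0 ≤ sahiE (s • μ) m (fun j => f (e j)) := by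
  intro m hm e he
  rcases m with _ | m
  · rw [sahiE_zero]
  · refine sahiE_smul_nonneg_of_sub μ hs0 hs1 m (fun j => f (e j)) fun m' hm' e' he' => ?_
    exact hpos m' (le_trans hm' hm) (fun j => e (e' j)) (he.comp he')

/-- **`s ↦ E_{n+1}^{s·μ}(f)/s` is non-increasing on `(0,1]`** (all orders): for `0 ≤ r ≤ s ≤ 1`, `s > 0`, and a family all of whose
proper sub-families (size `≤ n`) have `E_m^{μ} ≥ 0`: `r·E_{n+1}^{s·μ}(f) ≤ s·E_{n+1}^{r·μ}(f)` (the chord inequality for the weight `s·μ`,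
whose proper sub-family functionals are nonnegative by the scaling sum). [this work] -/
theorem mul_sahiE_smul_le (μ : α → ℝ) {r s : ℝ} (hr0 : 0 ≤ r) (hrs : r ≤ s) (hs1 : s ≤ 1) (hs : 0 < s)
    (f : Fin (n + 1) → α → ℝ)
    (hpos : ∀ m, m ≤ n → ∀ e : Fin m → Fin (n + 1), StrictMono e → 0 ≤ sahiE μ m (fun j => f (e j))) :
    r * sahiE (s • μ) (n + 1) f ≤ s * sahiE (r • μ) (n + 1) f := by
  have h := mul_sahiE_le_sahiE_smul (s • μ) (s := r / s) (div_nonneg hr0 hs.le) ((div_le_one hs).2 hrs) f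
    (sub_sahiE_smul_nonneg μ hs.le hs1 f hpos)
  rw [smul_smul, div_mul_cancel₀ r hs.ne'] at h
  calc r * sahiE (s • μ) (n + 1) f = s * (r / s * sahiE (s • μ) (n + 1) f) := by
        rw [← mul_assoc, mul_div_cancel₀ r hs.ne']
    _ ≤ s * sahiE (r • μ) (n + 1) f := mul_le_mul_of_nonneg_left h hs.le

/-! ### §2 The coin form: top-only slots on `Bool × α` under `B_s ⊗ ν` -/

omit [Fintype α] in
/-- A product of top-only slots is the top-only slot of the product (nonempty index set). [this work] -/
theorem prod_topOnly {ι : Type*} (S : Finset ι) (hS : S.Nonempty) (g : ι → α → ℝ) :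
    ∏ i ∈ S, (fun z : Bool × α => if z.1 then g i z.2 else 0) = fun z : Bool × α => if z.1 then (∏ i ∈ S, g i) z.2 else 0 := by
  funext z
  rcases z with ⟨b, x⟩
  rw [Finset.prod_apply]
  cases b
  · simp only [Bool.false_eq_true, if_false]
    obtain ⟨i, hi⟩ := hS
    exact Finset.prod_eq_zero hi rfl
  · simp only [if_true, Finset.prod_apply]

/-- **The top-only family under the coin product has the functionals of `f` under the scaled weight**:
`E_n^{B_s⊗ν}(ε·f_0,…,ε·f_{n−1}) = E_n^{s·ν}(f)` (both families have joint moments `s·E_ν(Π_{l∈S} f_l)`). [this work] -/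
theorem sahiE_coin_topOnly_eq_smul (ν : α → ℝ) (s : ℝ) (n : ℕ) (f : Fin n → α → ℝ) :
    sahiE (fun z : Bool × α => if z.1 then s * ν z.2 else (1 - s) * ν z.2) n (fun l (z : Bool × α) => if z.1 then f l z.2 else 0) =
      sahiE (s • ν) n f := by
  refine sahiE_congr_of_moments _ _ n _ _ fun S hS => ?_
  rw [prod_topOnly S hS, ex_coin_top, ex_smul_weight]

/-- **CONJECTURE V_∅ AT EVERY ORDER (coin form), conditionally on Sahi positivity of the proper sub-families**: for any real weight
`ν` on any finite type, `0 ≤ s ≤ 1`, and `n + 1` functions all of whose proper sub-families have `E_m^{ν} ≥ 0`: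
`s·E_{n+1}^{ν}(f) ≤ E_{n+1}^{B_s⊗ν}(ε·f_0,…,ε·f_n)`.  For events: `E_{n+1}(A_0 ∩ P,…,A_n ∩ P) ≥ μ(P)·E_{n+1}(A_0,…,A_n)` for an
independent event `P`. [this work] -/
theorem mul_sahiE_le_sahiE_coin_topOnly (ν : α → ℝ) {s : ℝ} (hs0 : 0 ≤ s) (hs1 : s ≤ 1) (f : Fin (n + 1) → α → ℝ)
    (hpos : ∀ m, m ≤ n → ∀ e : Fin m → Fin (n + 1), StrictMono e → 0 ≤ sahiE ν m (fun j => f (e j))) :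
    s * sahiE ν (n + 1) f ≤
      sahiE (fun z : Bool × α => if z.1 then s * ν z.2 else (1 - s) * ν z.2) (n + 1)
        (fun l (z : Bool × α) => if z.1 then f l z.2 else 0) := by
  rw [sahiE_coin_topOnly_eq_smul]
  exact mul_sahiE_le_sahiE_smul ν hs0 hs1 f hpos

/-- **Ratio form on the coin space**: `s ↦ E_{n+1}^{B_s⊗ν}(ε·f)/s` is non-increasing on `(0,1]` (all orders, under positivity of the
proper sub-families). [this work] -/
theorem mul_sahiE_coin_topOnly_le (ν : α → ℝ) {r s : ℝ} (hr0 : 0 ≤ r) (hrs : r ≤ s) (hs1 : s ≤ 1) (hs : 0 < s)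
    (f : Fin (n + 1) → α → ℝ)
    (hpos : ∀ m, m ≤ n → ∀ e : Fin m → Fin (n + 1), StrictMono e → 0 ≤ sahiE ν m (fun j => f (e j))) :
    r * sahiE (fun z : Bool × α => if z.1 then s * ν z.2 else (1 - s) * ν z.2) (n + 1)
        (fun l (z : Bool × α) => if z.1 then f l z.2 else 0) ≤
      s * sahiE (fun z : Bool × α => if z.1 then r * ν z.2 else (1 - r) * ν z.2) (n + 1)
        (fun l (z : Bool × α) => if z.1 then f l z.2 else 0) := by
  rw [sahiE_coin_topOnly_eq_smul, sahiE_coin_topOnly_eq_smul]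
  exact mul_sahiE_smul_le ν hr0 hrs hs1 hs f hpos

/-! ### §3 Sahi-positive weights: monotone nonnegative functions -/

section Positive

variable [Preorder α]

/-- **V_∅ from Sahi positivity of order `n`.**  On a finite preorder with a nonnegative probability weight `μ` that is Sahi-positive of
order `n` (hence of every order `≤ n`), for nonnegative monotone `f_0,…,f_n` and `0 ≤ s ≤ 1`: `s·E_{n+1}^{μ}(f) ≤ E_{n+1}^{s·μ}(f)`.
(Sahi positivity of order `n + 1` is NOT needed.) [this work] -/
theorem mul_sahiE_le_sahiE_smul_of_sahiPositive {μ : α → ℝ} (hμ₀ : ∀ x, 0 ≤ μ x) (hμ₁ : ∑ x, μ x = 1)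
    (hP : SahiPositive μ n) {s : ℝ} (hs0 : 0 ≤ s) (hs1 : s ≤ 1) (f : Fin (n + 1) → α → ℝ) (hf₀ : ∀ i x, 0 ≤ f i x)
    (hf : ∀ i, Monotone (f i)) : s * sahiE μ (n + 1) f ≤ sahiE (s • μ) (n + 1) f :=
  mul_sahiE_le_sahiE_smul μ hs0 hs1 f fun _ hm e _ => hP.anti hμ₀ hμ₁ hm _ (fun j x => hf₀ (e j) x) fun j => hf (e j)

/-- The same in coin form: `s·E_{n+1}^{μ}(f) ≤ E_{n+1}^{B_s⊗μ}(ε·f)`. [this work] -/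
theorem mul_sahiE_le_sahiE_coin_topOnly_of_sahiPositive {μ : α → ℝ} (hμ₀ : ∀ x, 0 ≤ μ x) (hμ₁ : ∑ x, μ x = 1)
    (hP : SahiPositive μ n) {s : ℝ} (hs0 : 0 ≤ s) (hs1 : s ≤ 1) (f : Fin (n + 1) → α → ℝ) (hf₀ : ∀ i x, 0 ≤ f i x)
    (hf : ∀ i, Monotone (f i)) :
    s * sahiE μ (n + 1) f ≤
      sahiE (fun z : Bool × α => if z.1 then s * μ z.2 else (1 - s) * μ z.2) (n + 1)
        (fun l (z : Bool × α) => if z.1 then f l z.2 else 0) :=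
  mul_sahiE_le_sahiE_coin_topOnly μ hs0 hs1 f fun _ hm e _ => hP.anti hμ₀ hμ₁ hm _ (fun j x => hf₀ (e j) x) fun j => hf (e j)

/-- **Scaled Sahi positivity**: if `μ` is Sahi-positive of order `n + 1` then `E_{n+1}^{s·μ}(f) ≥ 0` for nonnegative monotone `f` and
`0 ≤ s ≤ 1` (the sub-probability weight `s·μ` inherits positivity of that order). [this work] -/
theorem sahiE_smul_nonneg_of_sahiPositive {μ : α → ℝ} (hμ₀ : ∀ x, 0 ≤ μ x) (hμ₁ : ∑ x, μ x = 1)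
    (hP : SahiPositive μ (n + 1)) {s : ℝ} (hs0 : 0 ≤ s) (hs1 : s ≤ 1) (f : Fin (n + 1) → α → ℝ) (hf₀ : ∀ i x, 0 ≤ f i x)
    (hf : ∀ i, Monotone (f i)) : 0 ≤ sahiE (s • μ) (n + 1) f :=
  sahiE_smul_nonneg_of_sub μ hs0 hs1 n f fun _ hm e _ => hP.anti hμ₀ hμ₁ hm _ (fun j x => hf₀ (e j) x) fun j => hf (e j)

/-- **Ratio monotonicity from Sahi positivity of order `n`**: `r·E_{n+1}^{s·μ}(f) ≤ s·E_{n+1}^{r·μ}(f)` for `0 ≤ r ≤ s ≤ 1`, `s > 0`.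
[this work] -/
theorem mul_sahiE_smul_le_of_sahiPositive {μ : α → ℝ} (hμ₀ : ∀ x, 0 ≤ μ x) (hμ₁ : ∑ x, μ x = 1)
    (hP : SahiPositive μ n) {r s : ℝ} (hr0 : 0 ≤ r) (hrs : r ≤ s) (hs1 : s ≤ 1) (hs : 0 < s) (f : Fin (n + 1) → α → ℝ)
    (hf₀ : ∀ i x, 0 ≤ f i x) (hf : ∀ i, Monotone (f i)) : r * sahiE (s • μ) (n + 1) f ≤ s * sahiE (r • μ) (n + 1) f :=
  mul_sahiE_smul_le μ hr0 hrs hs1 hs f fun _ hm e _ => hP.anti hμ₀ hμ₁ hm _ (fun j x => hf₀ (e j) x) fun j => hf (e j)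

end Positive

/-! ### §4 FKG lattices: up-sets (the event form) and unconditional classes -/

section FKG

variable [DistribLattice α] [DecidableEq α]

/-- **Event form.**  On a finite distributive lattice with an FKG probability weight `ν` that is Sahi-positive of order `n`, for
`n + 1` ARBITRARY up-sets `U_l` and `0 ≤ s ≤ 1`:
`s·E_{n+1}^{ν}(1_{U_0},…,1_{U_n}) ≤ E_{n+1}^{B_s⊗ν}(ε·1_{U_0},…,ε·1_{U_n})` — `E_{n+1}(A_l ∩ P) ≥ μ(P)·E_{n+1}(A_l)` for an independent
event `P`.  Unconditional for `n + 1 ≤ 3` (`SahiPositive ν 2` = FKG); for `n + 1 = 4, 5` this is `…VertexFourFKG`/`…VertexFiveFKG`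
WITHOUT the positivity hypothesis (Harris certificates); for `n + 1 ≥ 6` it is new (conditional on `C_n` for `ν`). [this work] -/
theorem mul_sahiE_le_sahiE_coin_topOnly_of_isFKGMeasure {ν : α → ℝ} (hν : IsFKGMeasure ν) (hP : SahiPositive ν n)
    {s : ℝ} (hs0 : 0 ≤ s) (hs1 : s ≤ 1) (U : Fin (n + 1) → Finset α) (hU : ∀ l, IsUpperSet (U l : Set α)) :
    s * sahiE ν (n + 1) (fun l => setInd (U l)) ≤
      sahiE (fun z : Bool × α => if z.1 then s * ν z.2 else (1 - s) * ν z.2) (n + 1)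
        (fun l (z : Bool × α) => if z.1 then setInd (U l) z.2 else 0) :=
  mul_sahiE_le_sahiE_coin_topOnly_of_sahiPositive hν.nonneg hν.sum_eq_one hP hs0 hs1 _ (fun l x => setInd_nonneg (U l) x)
    fun l => monotone_setInd (hU l)

/-- **Unconditional, EVERY order, every FKG lattice with at most three join-irreducibles** (there Sahi positivity holds at every order,
`SahiCubeAllOrders.sahiPositive_of_card_supIrred_le_three`): `s·E_{n+1}^{ν}(f) ≤ E_{n+1}^{s·ν}(f)` for nonnegative monotone `f`.
[this work] -/
theorem mul_sahiE_le_sahiE_smul_of_card_supIrred_le_three (h3 : Nat.card {j : α // SupIrred j} ≤ 3) {ν : α → ℝ}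
    (hν : IsFKGMeasure ν) {s : ℝ} (hs0 : 0 ≤ s) (hs1 : s ≤ 1) (f : Fin (n + 1) → α → ℝ) (hf₀ : ∀ i x, 0 ≤ f i x)
    (hf : ∀ i, Monotone (f i)) : s * sahiE ν (n + 1) f ≤ sahiE (s • ν) (n + 1) f :=
  mul_sahiE_le_sahiE_smul_of_sahiPositive hν.nonneg hν.sum_eq_one (SahiCubeAllOrders.sahiPositive_of_card_supIrred_le_three h3 hν n)
    hs0 hs1 f hf₀ hf

end FKG

/-- **Unconditional, EVERY order, every two-dimensional grid** `α × β` (two finite linear orders, componentwise order, any FKG weight —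
the discrete Lieb–Sahi Conjecture 1.1 in dimension two is a tree theorem, `SahiTwoDim.sahiPositive_of_isFKGMeasure_prod`):
`s·E_{n+1}^{ν}(f) ≤ E_{n+1}^{s·ν}(f)` for nonnegative monotone `f`. [this work] -/
theorem mul_sahiE_le_sahiE_smul_of_prod {β γ : Type*} [LinearOrder β] [Fintype β] [LinearOrder γ] [Fintype γ] {ν : β × γ → ℝ}
    (hν : IsFKGMeasure ν) {s : ℝ} (hs0 : 0 ≤ s) (hs1 : s ≤ 1) (f : Fin (n + 1) → β × γ → ℝ) (hf₀ : ∀ i x, 0 ≤ f i x)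
    (hf : ∀ i, Monotone (f i)) : s * sahiE ν (n + 1) f ≤ sahiE (s • ν) (n + 1) f :=
  mul_sahiE_le_sahiE_smul_of_sahiPositive hν.nonneg hν.sum_eq_one (SahiTwoDim.sahiPositive_of_isFKGMeasure_prod hν n)
    hs0 hs1 f hf₀ hf

end

end Summit.CriticalPhenomena.PercolationContinuityZ3.Theorems.SahiTangent
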